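import Mathlib.Analysis.Analytic.Binomial
import Mathlib.Analysis.Analytic.Uniqueness
import Mathlib.Analysis.Complex.CauchyIntegral
import Mathlib.Analysis.SpecialFunctions.ImproperIntegrals
import Mathlib.MeasureTheory.Integral.IntegralEqImproper
import Mathlib.Topology.Connected.LocallyConnected
import Mathlib.RingTheory.PowerSeries.Basic
import Literature.Barriers.Schanuel.EFunctionValuesAtAlgebraicPoints
import HarnessLib

/-!
# Э-functions (André's anti-`E`-functions), their Borel–Laplace `1`-summation, and the ring `𝐃` of Э-values

`Literature/NumberTheory/Transcendental/AntiEFunction.lean` — definitions, modelled on (and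
importing) the tree's strict `E`-functions `Literature.Barriers.Schanuel.eSeries /
IsStrictEFunction / eValues` (Rivoal, Déf. 5.2 = Fischler–Rivoal's `E`-functions).

## What the sources print

* [Andre2000GevreyI] Y. André, *Séries Gevrey de type arithmétique, I*, Ann. of Math. 151 (2000),
  §2.2 (p. 713): for a sequence `a = (aₙ)` of algebraic numbers satisfying `(G)` (conjugates and
  common denominators of `a₀, …, aₙ` grow at most geometrically) and `(H)` (holonomy), the series
  `f_a = ∑ aₙzⁿ` "est de type `G`, ou est une `G`-fonction", `F_a = ∑ aₙzⁿ/n!` "est de type `E`,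
  ou est une `E`-fonction", and "Il y a lieu de considérer aussi la série `𝔣_a = ∑ n!·aₙ·zⁿ`. Nous
  donnerons à une telle série le nom de série de type Э, ou Э-fonction (elle diverge aux places
  archimédiennes …)"; §2.1: `f_a` is holonomic iff `F_a` is (table (2.1.2)–(2.1.5)); p. 714: the
  Euler series `∑ (−1)ⁿ n! zⁿ⁺¹` is the asymptotic expansion at `0` of `∫₀^∞ e^{−w/z}/(1+w) dw`.
* [FischlerRivoal2024] S. Fischler, T. Rivoal, J. Number Theory 261 (2024) (arXiv:2301.13518), §1
  (pp. 2–3): "a power series `∑ aₙxⁿ ∈ ℚ̄[[x]]` is said to be a `G`-function when `∑ aₙxⁿ/n!` is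
  an `E`-function. In this case, `∑ n!aₙzⁿ` is called an Э-function … Э-functions are divergent
  series, unless they are polynomials. Given an Э-function `𝔣` and any `θ ∈ ℝ`, except finitely
  many values mod `2π` (namely anti-Stokes directions of `𝔣`), one can perform Ramis'
  `1`-summation of `𝔣(1/z)` in the direction `θ`, which coincides in this setting with
  Borel–Laplace summation … This provides a function denoted by `𝔣_θ(1/z)`, holomorphic on the open
  subset of `ℂ` consisting in all `z ≠ 0` such that `θ − π/2 − ε < arg z < θ + π/2 + ε` for some
  `ε > 0`"; "`𝐃` [is the set] of all values `𝔣_θ(1)` where `𝔣` is an Э-function (`θ = 0` if it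
  is not an anti-Stokes direction, and `θ > 0` is very small otherwise.) These three sets are
  countable sub-rings of `ℂ` that all contain `ℚ̄` … (The ring `𝐃` is denoted by [another letter]
  in [FischlerRivoal2018].)"; Conjecture 1: `𝐄 ∩ 𝐃 = ℚ̄`; Conjecture 2 and Theorem 3 (the
  Э-analogue of Beukers/Siegel–Shidlovskii under Conjecture 2, for `ξ ∈ ℚ̄*`,
  `θ ∈ (arg ξ − π/2, arg ξ + π/2)`, values `𝔣_{j,θ}(1/ξ)`); §2 (mixed functions, Conjecture 3,
  Theorem 4); §5.2: for `𝔣(z) = ∑ s(s−1)⋯(s−n+1)zⁿ`, "`0` is not an anti-Stokes direction" and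
  "this `1`-summation is `∫₀^∞ (1 + tz)^s e^{−t} dt`".
* [FischlerRivoal2018] S. Fischler, T. Rivoal, *Microsolutions …*, Amer. J. Math. 140 (2018)
  (arXiv:1506.03574), §1 and §4.3 — the paper DEFINING `𝐃`: "the set of all complex numbers
  `𝔣_θ(ξ)` where `ξ ∈ ℚ̄*` and `𝔣` is an Э-function; here `θ = arg(ξ)` and `𝔣_θ = 𝒜_θ⁻¹𝔣` is
  Ramis' `1`-summation of `𝔣` in the direction `θ` if `θ` is not anti-Stokes, and
  `𝔣_θ = 𝒜_{θ+ε}⁻¹𝔣` for any small `ε > 0` if `θ` is anti-Stokes (this is independent from the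
  choice of such an `ε`)"; §4.3: for `𝔣(1/x) = ∑_{n≥1} aₙx⁻ⁿ` with formal Borel transform
  `g(z) = ∑_{n≥1} aₙ zⁿ⁻¹/(n−1)!` (a `G`-function), "`𝒜_θ⁻¹𝔣(1/x) = ∫₀^{e^{iθ}∞} g(z)e^{−xz} dz`
  provided `|arg(1/x) − θ| < π/2` (see [Ramis]), in particular for `1/x = ξ`. Moreover letting
  `𝔣̃(x) = 𝔣(ξx)` we have `𝔣̃₀(1) = 𝔣_θ(ξ)` so that we may restrict to `ξ = 1` in the definition
  of `𝐃`; therefore `𝐃` is a ring"; `𝐃` "contains algebraic numbers, Gompertz's constant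
  `∫₀^∞ e^{−t}/(1+t) dt`, and `√π·Ai(z)` for any `z ∈ ℚ̄`"; Remark 7 (end of §4.3): "we could
  have considered `𝒜_{θ−ε}⁻¹𝔣` instead of `𝒜_{θ+ε}⁻¹𝔣` if `θ` is anti-Stokes. This defines also a
  ring `𝐃′`, and all properties of `𝐃` stated in this paper hold also with `𝐃′`. However we have
  not been able to prove that `𝐃′ = 𝐃`."
* [FischlerRivoal2016] (*Arithmetic theory of `E`-operators*, J. Éc. polytech. Math. 3),
  Definition 1 (`E`-functions, strict sense) and Definition 5 (§4.1): asymptotic expansion "in a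
  large sector bisected by the direction `θ`" (`θ − π/2 − ε ≤ arg(x) ≤ θ + π/2 + ε`) "means
  exactly (see [Ramis]) that [the series] is `1`-summable in the direction `θ`".

## Lean rendering (design)

* `antiESeries a : PowerSeries ℂ` is the FORMAL series `∑ n!·aₙ·xⁿ` (it converges nowhere unless
  it is a polynomial, so it is not rendered as a function); `IsAntiEFunction f` says that the
  formal series `f = ∑ cₙxⁿ` is an Э-function, i.e. `cₙ = n!·aₙ` with `IsStrictEFunction a`
  (Fischler–Rivoal's definition verbatim, `a = (cₙ/n!)`); `isAntiEFunction_iff` makes this explicit.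
* Borel–Laplace summation, with the Borel-plane direction EXPLICIT. The formal Borel transform of
  `𝔣_a(1/z) = ∑ n!aₙz⁻ⁿ` (w.r.t. `1/z`) is the `G`-series `∑ aₙξⁿ`, convergent near `0`;
  `IsBorelRayContinuation a d G` says `G` continues it analytically along the closed ray
  `borelRay d = e^{id}·[0, ∞)` (unique on the ray: `IsBorelRayContinuation.eqOn_borelRay`, identity
  theorem). The Laplace integral along that ray is
  `antiELaplace G d z = z·∫₀^∞ G(re^{id}) e^{−z re^{id}} e^{id} dr = z∫₀^{e^{id}∞} G(ξ)e^{−zξ}dξ`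
  (since `z∫₀^∞ ξⁿe^{−zξ}dξ = n!·z⁻ⁿ` it resums `∑ n!aₙz⁻ⁿ`; it is Fischler–Rivoal's
  `∫₀^{e^{id}∞} g(ξ)e^{−zξ}dξ + (constant term)` with the shifted Borel transform `g = G′` after one
  integration by parts), absolutely convergent exactly on the half-plane `|arg z + d| < π/2` when
  `G` has moderate growth; `IsBorelLaplaceSum a d z w` says `w` is this (absolutely convergent)
  integral for some — hence any: `IsBorelLaplaceSum.unique` — continuation.
* Naming of directions in the sources. [FischlerRivoal2018] attach the direction to the Borel ray
  itself (`θ = arg ξ`, ray `e^{iθ}[0,∞)`, sum evaluated at the point `1/x = ξ`);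
  [FischlerRivoal2024] write the same sums `𝔣_θ(1/z)` with `θ` a direction of the LARGE variable
  `z` (domain `|arg z − θ| < π/2 + ε`; Theorem 3 takes `θ ∈ (arg ξ − π/2, arg ξ + π/2)` to
  evaluate at `z = ξ`), which by the convergence condition is the ray of direction `−θ`. We provide
  `IsAntiESum a θ z w := IsBorelLaplaceSum a (−θ) z w` in the labelling of [FischlerRivoal2024]
  (so that its Conjecture 2 / Theorems 3–4 can be typed verbatim) and `antiESum a θ z` for its
  value (junk `0` when there is none); for `θ = 0` and real `z = x > 0` it is the familiar
  `∫₀^∞ e^{−t} G(t/x) dt` (`antiELaplace_zero_ofReal`), e.g. `∫₀^∞ e^{−t}(1 + t/x)^s dt` for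
  `G(ξ) = (1+ξ)^s` [FischlerRivoal2024, §5.2]; with `s = −1/2`, `x = 1` this is
  `∫₀^∞ e^{−t}/√(1+t) dt`, the Э-value of route `Summits/Schanuel/Schanuel/Theses/StokesConstantPi.lean`.
* `antiEValues` is `𝐃` AS DEFINED in [FischlerRivoal2018, §1, §4.3], at `ξ = 1` (loc. cit.: "we
  may restrict to `ξ = 1`"), literally: either the Borel ray of direction `0` can be used (the
  `G`-series continues analytically along `[0, ∞)` with absolutely convergent Laplace integral at
  `z = 1` — for an Э-function this is exactly "`0` is not anti-Stokes") and `w` is that sum, or it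
  cannot and `w` is the common value of the sums along the rays of direction `d` for all small
  `d > 0` (`𝒜_{0+ε}⁻¹`, "independent from the choice of such an `ε`"). [FischlerRivoal2024, §1]
  states that its `𝐃` is this ring. The mirror choice `𝒜_{0−ε}⁻¹` is `antiEValues'` (`𝐃′` of
  [FischlerRivoal2018, Remark 7]; `𝐃 = 𝐃′` is not known) — note that "`θ > 0` very small" read in
  the large-variable labelling of [FischlerRivoal2024] would be `𝐃′`. Anti-Stokes directions as a
  notion (attached to the minimal differential operator) are not needed beyond this and are not
  defined here.
* PROVED API: coefficient/recognition lemmas for `antiESeries` / `IsAntiEFunction`; the Euler-type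
  series `∑ n! xⁿ` and the constant `1` are Э-functions (`isAntiEFunction_antiESeries_one` from the
  tree's `isStrictEFunction_exp`; `isAntiEFunction_one`); uniqueness of continuations and of sums;
  the `θ = 0` real-axis formula; non-vacuity: `1 ∈ antiEValues`, `1 ∈ antiEValues'` (constant
  Э-function `1`, `G = 1`, `∫₀^∞ e^{−re^{id}} e^{id} dr = 1` for `|d| < π/2`), instances of the
  printed "`𝐃` contains algebraic numbers"; and the ANALYTIC half of Fischler–Rivoal's example
  `𝔣(z) = ∑ s(s−1)⋯(s−n+1)zⁿ = 𝔣_a`, `aₙ = C(s,n)` (`Ring.choose s n`): its `G`-series sums to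
  `(1+ξ)^s` (Mathlib's binomial series), which continues it along every ray of direction `|d| < π`
  (`isBorelRayContinuation_one_add_cpow`), and for `Re s ≤ 0`, `x > 0` the `1`-sum in the
  direction `0` is `𝔣₀(1/x) = ∫₀^∞ e^{−t}(1 + t/x)^s dt` (`isBorelLaplaceSum_binomial`; §5.2 of the
  source); hence `∫₀^∞ e^{−t}(1+t)^s dt ∈ 𝐃` CONDITIONALLY on the arithmetic half
  `IsStrictEFunction (C(s,n))ₙ` (`integral_mem_antiEValues_of_isStrictEFunction`; `s = −1/2` is the
  route's `∫₀^∞ e^{−t}/√(1+t) dt`).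
* NOT here: mixed functions and Fischler–Rivoal's Conjectures 1–3 / Theorems 3–4 (to be stated by
  their users over these definitions); the analytic theory in general (existence of the
  continuation with moderate growth off finitely many directions — André–Chudnovsky–Katz —,
  independence of the lateral direction); the arithmetic half of the example, i.e. that
  `aₙ = C(s,n)` (`s ∈ ℚ`; for `s = −1/2`, `aₙ = (−1)ⁿ·C(2n,n)/4ⁿ`) satisfies `IsStrictEFunction`
  (holonomy of `∑ C(s,n)zⁿ/n!`, denominators), and the case `Re s > 0` of the Laplace integral.
-/

noncomputable section

open Complex MeasureTheory Set Filter
open scoped Nat Topology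

namespace Literature.NumberTheory.Transcendental

open Literature.Barriers.Schanuel

/-! ### 1. Э-series and Э-functions (formal) -/

/-- The **Э-series** attached to a coefficient sequence `a`: the formal power series
`𝔣_a(x) = ∑ₙ n!·aₙ·xⁿ ∈ ℂ⟦x⟧`, companion of the `E`-series `F_a(z) = ∑ aₙzⁿ/n!` (`eSeries a`) and
of the `G`-series `∑ aₙξⁿ` ("Il y a lieu de considérer aussi la série `𝔣 = ∑ n!aₙzⁿ` … série de
type Э, ou Э-fonction"). Purely formal: it diverges at every `x ≠ 0` unless it is a polynomial.
[cite: Andre2000GevreyI, §2.2 (p. 713)] -/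
def antiESeries (a : ℕ → ℂ) : PowerSeries ℂ :=
  PowerSeries.mk fun n => (n ! : ℂ) * a n

/-- Coefficients of the Э-series: `[xⁿ] 𝔣_a = n!·aₙ`. [cite: Andre2000GevreyI, §2.2 (p. 713)] -/
@[simp] theorem coeff_antiESeries (a : ℕ → ℂ) (n : ℕ) :
    PowerSeries.coeff n (antiESeries a) = (n ! : ℂ) * a n :=
  PowerSeries.coeff_mk _ _

/-- Recovering the `E`-coefficients: `[xⁿ] 𝔣_a / n! = aₙ`. [folklore] -/
@[simp] theorem coeff_antiESeries_div_factorial (a : ℕ → ℂ) (n : ℕ) :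
    PowerSeries.coeff n (antiESeries a) / (n ! : ℂ) = a n := by
  have hn : (n ! : ℂ) ≠ 0 := by exact_mod_cast Nat.factorial_ne_zero n
  rw [coeff_antiESeries, mul_div_cancel_left₀ _ hn]

/-- Every formal series is the Э-series of its `E`-coefficients `cₙ/n!`. [folklore] -/
theorem antiESeries_coeff_div_factorial (f : PowerSeries ℂ) :
    antiESeries (fun n => PowerSeries.coeff n f / (n ! : ℂ)) = f := by
  ext n
  have hn : (n ! : ℂ) ≠ 0 := by exact_mod_cast Nat.factorial_ne_zero n
  rw [coeff_antiESeries, mul_div_cancel₀ _ hn]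

/-- **Э-function** (André; Fischler–Rivoal): a formal power series `f = ∑ cₙxⁿ ∈ ℂ⟦x⟧` is an
Э-function when `cₙ = n!·aₙ` where `∑ aₙzⁿ/n!` is an `E`-function (strict sense: `aₙ ∈ ℚ̄`,
holonomic, conjugates `|σ(aₙ)| ≤ C^{n+1}`, common denominators of `a₀, …, aₙ` at most `D^{n+1}`),
i.e. `IsStrictEFunction (cₙ/n!)ₙ` ("a power series `∑ aₙxⁿ ∈ ℚ̄[[x]]` is said to be a
`G`-function when `∑ aₙxⁿ/n!` is an `E`-function. In this case, `∑ n!aₙzⁿ` is called an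
Э-function"). [cite: FischlerRivoal2024, §1 (p. 2)] -/
def IsAntiEFunction (f : PowerSeries ℂ) : Prop :=
  IsStrictEFunction fun n => PowerSeries.coeff n f / (n ! : ℂ)

/-- Unfolding `IsAntiEFunction`. [cite: FischlerRivoal2024, §1 (p. 2)] -/
theorem isAntiEFunction_iff (f : PowerSeries ℂ) :
    IsAntiEFunction f ↔ IsStrictEFunction fun n => PowerSeries.coeff n f / (n ! : ℂ) :=
  Iff.rfl

/-- `𝔣_a = ∑ n!aₙxⁿ` is an Э-function iff `(aₙ)` are the coefficients of a (strict) `E`-function.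
[cite: FischlerRivoal2024, §1 (p. 2)] -/
theorem isAntiEFunction_antiESeries_iff (a : ℕ → ℂ) :
    IsAntiEFunction (antiESeries a) ↔ IsStrictEFunction a := by
  rw [isAntiEFunction_iff]
  have : (fun n => PowerSeries.coeff n (antiESeries a) / (n ! : ℂ)) = a :=
    funext (coeff_antiESeries_div_factorial a)
  rw [this]

/-- Э-functions are exactly the Э-series `∑ n!aₙxⁿ` of `E`-coefficient sequences `a` (André's
"séries associées" `f_a`, `F_a`, `𝔣_a` to one and the same `a`).
[cite: Andre2000GevreyI, §2.2 (p. 713)] -/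
theorem isAntiEFunction_iff_exists (f : PowerSeries ℂ) :
    IsAntiEFunction f ↔ ∃ a : ℕ → ℂ, IsStrictEFunction a ∧ f = antiESeries a := by
  constructor
  · intro h
    exact ⟨_, h, (antiESeries_coeff_div_factorial f).symm⟩
  · rintro ⟨a, ha, rfl⟩
    exact (isAntiEFunction_antiESeries_iff a).2 ha

/-- **The Euler-type series `∑ n! xⁿ` is an Э-function** (PROVED): it is `𝔣_a` for `a = (1)ₙ`,
whose `E`-series is `e^z` (`isStrictEFunction_exp`), whose `G`-series is `1/(1−ξ)`; André's example
a) "`f = 1/(1−z)`, `F = e^z`" (its sign-twisted sibling `∑ (−1)ⁿn!zⁿ⁺¹` is Euler's series, p. 714).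
[cite: Andre2000GevreyI, §2.2 (pp. 713–714)] -/
theorem isAntiEFunction_antiESeries_one : IsAntiEFunction (antiESeries fun _ => 1) :=
  (isAntiEFunction_antiESeries_iff _).2 isStrictEFunction_exp

/-! ### 2. Borel transform along a ray and the Laplace integral (`1`-summation) -/

/-- The closed ray `e^{id}·[0, ∞) = {r e^{id} : r ≥ 0}` of the Borel plane in the direction `d`.
[folklore] -/
def borelRay (d : ℝ) : Set ℂ :=
  (fun r : ℝ => (r : ℂ) * cexp (d * I)) '' Ici 0

/-- `r e^{id} ∈ borelRay d` for `r ≥ 0`. [folklore] -/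
theorem ofReal_mul_exp_mem_borelRay {d r : ℝ} (hr : 0 ≤ r) :
    (r : ℂ) * cexp (d * I) ∈ borelRay d :=
  ⟨r, hr, rfl⟩

/-- The origin lies on every ray. [folklore] -/
theorem zero_mem_borelRay (d : ℝ) : (0 : ℂ) ∈ borelRay d :=
  ⟨0, Set.self_mem_Ici, by simp⟩

/-- A ray is (pre)connected. [folklore] -/
theorem isPreconnected_borelRay (d : ℝ) : IsPreconnected (borelRay d) :=
  isPreconnected_Ici.image _ (by fun_prop)

/-- **Analytic continuation of the Borel transform along a ray.** The formal Borel transform of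
`𝔣_a(1/z) = ∑ n!·aₙ·z⁻ⁿ` with respect to `1/z` is the `G`-series `∑ aₙξⁿ` (positive radius of
convergence when `|aₙ| ≤ C^{n+1}`); `IsBorelRayContinuation a d G` says that `G : ℂ → ℂ` is an
analytic continuation of it along the whole closed ray `borelRay d`: `G` is holomorphic on an open
set containing the ray and sums the `G`-series near the origin. (For a `G`-function this exists for
all but finitely many directions `d` mod `2π` — the rays through its finitely many singularities —;
not proved here.) This is the datum of the Borel–Laplace procedure as used for Э-functions in the
source ("its formal Borel transform `g(z)` … is a `G`-function, and we have
`𝒜_θ⁻¹𝔣(1/x) = ∫₀^{e^{iθ}∞} g(z)e^{−xz} dz`"). [cite: FischlerRivoal2018, §4.3] -/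
structure IsBorelRayContinuation (a : ℕ → ℂ) (d : ℝ) (G : ℂ → ℂ) : Prop where
  /-- `G` is holomorphic on an open neighbourhood of the closed ray `e^{id}·[0,∞)` -/
  exists_isOpen : ∃ U : Set ℂ, IsOpen U ∧ borelRay d ⊆ U ∧ DifferentiableOn ℂ G U
  /-- near `0`, `G` is the sum of the (convergent) `G`-series `∑ aₙξⁿ` -/
  hasSum_nhds_zero : ∀ᶠ ξ in 𝓝 (0 : ℂ), HasSum (fun n => a n * ξ ^ n) (G ξ)

/-- **Uniqueness of the continuation along a ray** (identity theorem): two analytic continuations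
of the same `G`-series along the ray `borelRay d` agree on the ray. PROVED. [folklore] -/
theorem IsBorelRayContinuation.eqOn_borelRay {a : ℕ → ℂ} {d : ℝ} {G₁ G₂ : ℂ → ℂ}
    (h₁ : IsBorelRayContinuation a d G₁) (h₂ : IsBorelRayContinuation a d G₂) :
    EqOn G₁ G₂ (borelRay d) := by
  obtain ⟨U₁, hU₁, hR₁, hG₁⟩ := h₁.exists_isOpen
  obtain ⟨U₂, hU₂, hR₂, hG₂⟩ := h₂.exists_isOpen
  set U : Set ℂ := U₁ ∩ U₂
  have hU : IsOpen U := hU₁.inter hU₂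
  have hRU : borelRay d ⊆ U := subset_inter hR₁ hR₂
  set V : Set ℂ := connectedComponentIn U 0
  have hV : IsOpen V := hU.connectedComponentIn
  have hVpre : IsPreconnected V := isPreconnected_connectedComponentIn
  have hRV : borelRay d ⊆ V :=
    (isPreconnected_borelRay d).subset_connectedComponentIn (zero_mem_borelRay d) hRU
  have h0V : (0 : ℂ) ∈ V := hRV (zero_mem_borelRay d)
  have hVU : V ⊆ U := connectedComponentIn_subset U 0
  have hA₁ : AnalyticOnNhd ℂ G₁ V :=
    (hG₁.mono (hVU.trans inter_subset_left)).analyticOnNhd hV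
  have hA₂ : AnalyticOnNhd ℂ G₂ V :=
    (hG₂.mono (hVU.trans inter_subset_right)).analyticOnNhd hV
  have hfg : G₁ =ᶠ[𝓝 (0 : ℂ)] G₂ := by
    filter_upwards [h₁.hasSum_nhds_zero, h₂.hasSum_nhds_zero] with ξ hξ₁ hξ₂
    exact hξ₁.unique hξ₂
  exact (hA₁.eqOn_of_preconnected_of_eventuallyEq hA₂ hVpre h0V hfg).mono hRV

/-- The integrand of the Laplace integral of `G` along the ray of direction `d`, at the point `z`,
parametrised by arc length `r > 0`: `e^{id} · e^{−z·re^{id}} · G(re^{id})`.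
[cite: FischlerRivoal2018, §4.3] -/
def antiELaplaceIntegrand (G : ℂ → ℂ) (d : ℝ) (z : ℂ) (r : ℝ) : ℂ :=
  cexp (d * I) * cexp (-(z * ((r : ℂ) * cexp (d * I)))) * G ((r : ℂ) * cexp (d * I))

/-- **The Laplace integral along the Borel ray of direction `d`**:
`antiELaplace G d z = z · ∫₀^∞ G(re^{id}) e^{−z re^{id}} e^{id} dr = z ∫₀^{e^{id}∞} G(ξ)e^{−zξ} dξ`
(Bochner integral; meaningful when the integrand is integrable, which for `G` of moderate growth
happens exactly on the half-plane `|arg z + d| < π/2`). Since `z∫₀^∞ ξⁿe^{−zξ}dξ = n!·z⁻ⁿ`,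
applied to (a continuation of) the `G`-series `∑ aₙξⁿ` it resums the Э-series
`𝔣_a(1/z) = ∑ n!aₙz⁻ⁿ` (Borel–Laplace = Ramis' `1`-summation); the source writes the same integral
with the shifted Borel transform `g = G′` and no prefactor, `∫₀^{e^{id}∞} g(ξ)e^{−zξ}dξ`
(+ constant term), which is this one after an integration by parts. [cite: FischlerRivoal2018, §4.3] -/
def antiELaplace (G : ℂ → ℂ) (d : ℝ) (z : ℂ) : ℂ :=
  z * ∫ r in Ioi (0 : ℝ), antiELaplaceIntegrand G d z r

/-- **The real-axis formula.** In the direction `d = 0` and at a real point `z = x > 0` the Laplace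
integral is `∫₀^∞ e^{−t} G(t/x) dt` (substitute `t = x r`) — the shape in which such `1`-sums are
usually printed, e.g. `𝔣₀(1/z) = ∫₀^∞ (1 + t/z)^s e^{−t} dt` for `G(ξ) = (1+ξ)^s`. PROVED.
[cite: FischlerRivoal2024, §5.2] -/
theorem antiELaplace_zero_ofReal (G : ℂ → ℂ) {x : ℝ} (hx : 0 < x) :
    antiELaplace G 0 x = ∫ t in Ioi (0 : ℝ), cexp (-(t : ℂ)) * G (t / x) := by
  have hx0 : (x : ℂ) ≠ 0 := by exact_mod_cast hx.ne'
  have hint : (fun r : ℝ => antiELaplaceIntegrand G 0 x r) =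
      fun r : ℝ => (fun t : ℝ => cexp (-(t : ℂ)) * G (t / x)) (x * r) := by
    funext r
    simp only [antiELaplaceIntegrand, Complex.ofReal_zero, zero_mul, Complex.exp_zero, one_mul,
      mul_one, Complex.ofReal_mul]
    rw [mul_div_cancel_left₀ _ hx0]
  rw [antiELaplace, hint, integral_comp_mul_left_Ioi (fun t : ℝ => cexp (-(t : ℂ)) * G (t / x)) 0 hx,
    mul_zero, Complex.real_smul, ← mul_assoc, Complex.ofReal_inv, mul_inv_cancel₀ hx0, one_mul]

/-- **Borel–Laplace sum along a Borel ray.** `IsBorelLaplaceSum a d z w`: `w` is the Borel–Laplace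
sum of the Э-series `𝔣_a(1/z) = ∑ n!aₙz⁻ⁿ` at the point `z`, computed along the Borel-plane ray of
direction `d`: for some analytic continuation `G` of the `G`-series `∑ aₙξⁿ` along `borelRay d`,
the Laplace integral `z∫₀^{e^{id}∞} G(ξ)e^{−zξ}dξ` converges absolutely and equals `w`
("`𝒜_θ⁻¹𝔣(1/x) = ∫₀^{e^{iθ}∞} g(z)e^{−xz} dz` provided `|arg(1/x) − θ| < π/2`", there with
`θ = d`, `x = z`). The value does not depend on the continuation chosen
(`IsBorelLaplaceSum.unique`). [cite: FischlerRivoal2018, §4.3] -/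
def IsBorelLaplaceSum (a : ℕ → ℂ) (d : ℝ) (z w : ℂ) : Prop :=
  ∃ G : ℂ → ℂ, IsBorelRayContinuation a d G ∧
    IntegrableOn (antiELaplaceIntegrand G d z) (Ioi 0) ∧ w = antiELaplace G d z

/-- **The Borel–Laplace sum is well defined**: its value does not depend on the analytic
continuation used (continuations agree on the ray). PROVED. [folklore] -/
theorem IsBorelLaplaceSum.unique {a : ℕ → ℂ} {d : ℝ} {z w w' : ℂ}
    (h : IsBorelLaplaceSum a d z w) (h' : IsBorelLaplaceSum a d z w') : w = w' := by
  obtain ⟨G, hG, -, rfl⟩ := h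
  obtain ⟨G', hG', -, rfl⟩ := h'
  unfold antiELaplace
  congr 1
  refine setIntegral_congr_fun measurableSet_Ioi fun r hr => ?_
  simp only [antiELaplaceIntegrand]
  rw [hG.eqOn_borelRay hG' (ofReal_mul_exp_mem_borelRay (le_of_lt hr))]

/-- **Fischler–Rivoal's `1`-sum `𝔣_{a,θ}(1/z)` in the direction `θ`**, in the labelling of
[FischlerRivoal2024]: there `θ` is a direction of the (large) variable `z` — "`𝔣_θ(1/z)`,
holomorphic on … `θ − π/2 − ε < arg z < θ + π/2 + ε` …, of which `𝔣(1/z)` is the asymptotic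
expansion in this sector"; Theorem 3 evaluates at `z = ξ` for `θ ∈ (arg ξ − π/2, arg ξ + π/2)` —
so the Borel-plane ray carrying it is the one of direction `−θ` (the Laplace integral
`z∫₀^{e^{id}∞}G(ξ)e^{−zξ}dξ` converges exactly for `|arg z + d| < π/2`): `IsAntiESum a θ z w :=
IsBorelLaplaceSum a (−θ) z w`, "`w = 𝔣_{a,θ}(1/z)`" on the open half-plane `|arg z − θ| < π/2`
(which contains every evaluation point used in the source; the continuation of `𝔣_θ` to the LARGE
sector, by rotating the ray slightly, is not formalised). [FischlerRivoal2018, §4.3] label the SAME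
sum by the direction `arg(1/z) = −θ` of the Borel ray instead. For `θ = 0`, `z = x > 0` it reads
`∫₀^∞ e^{−t}G(t/x) dt` (`antiELaplace_zero_ofReal`). `θ` is implicitly assumed not anti-Stokes in
the source; for an anti-Stokes `θ` there is in general no continuation along the ray and the
predicate is empty. [cite: FischlerRivoal2024, §1 (p. 3)] -/
def IsAntiESum (a : ℕ → ℂ) (θ : ℝ) (z w : ℂ) : Prop :=
  IsBorelLaplaceSum a (-θ) z w

/-- Unfolding `IsAntiESum`: the Borel ray of `𝔣_θ` ([FischlerRivoal2024] labelling) has direction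
`−θ`. [cite: FischlerRivoal2024, §1 (p. 3)] -/
theorem isAntiESum_iff (a : ℕ → ℂ) (θ : ℝ) (z w : ℂ) :
    IsAntiESum a θ z w ↔ IsBorelLaplaceSum a (-θ) z w :=
  Iff.rfl

/-- In the direction `θ = 0` the Borel ray is the positive real axis (both labellings agree).
[cite: FischlerRivoal2024, §1 (p. 3)] -/
theorem isAntiESum_zero_iff (a : ℕ → ℂ) (z w : ℂ) :
    IsAntiESum a 0 z w ↔ IsBorelLaplaceSum a 0 z w := by
  rw [isAntiESum_iff, neg_zero]

/-- `𝔣_{a,θ}(1/z)` has at most one value. PROVED. [folklore] -/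
theorem IsAntiESum.unique {a : ℕ → ℂ} {θ : ℝ} {z w w' : ℂ} (h : IsAntiESum a θ z w)
    (h' : IsAntiESum a θ z w') : w = w' :=
  IsBorelLaplaceSum.unique h h'

open Classical in
/-- **The value `𝔣_{a,θ}(1/z)`** of the `1`-sum of the Э-series `𝔣_a` in the direction `θ`
([FischlerRivoal2024] labelling) at the point `z`, as a total function: the `w` with
`IsAntiESum a θ z w` when it exists (it is then unique, `IsAntiESum.antiESum_eq`), and the junk
value `0` otherwise (documented junk value: only meaningful under `∃ w, IsAntiESum a θ z w`, i.e.
for `θ` not anti-Stokes and `|arg z − θ| < π/2`). [cite: FischlerRivoal2024, §1 (p. 3)] -/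
def antiESum (a : ℕ → ℂ) (θ : ℝ) (z : ℂ) : ℂ :=
  if h : ∃ w, IsAntiESum a θ z w then Classical.choose h else 0

/-- Specification of `antiESum`: it is the `1`-sum whenever one exists. PROVED. [folklore] -/
theorem IsAntiESum.antiESum_eq {a : ℕ → ℂ} {θ : ℝ} {z w : ℂ} (h : IsAntiESum a θ z w) :
    antiESum a θ z = w := by
  have hex : ∃ w, IsAntiESum a θ z w := ⟨w, h⟩
  rw [antiESum, dif_pos hex]
  exact (Classical.choose_spec hex).unique h

/-! ### 3. The ring `𝐃` of Э-values (and its mirror `𝐃′`) -/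

/-- **The set `𝐃` of Э-values**, as defined by Fischler–Rivoal (2018): the values at `ξ = 1` —
"we may restrict to `ξ = 1` in the definition of `𝐃`" — of `1`-summed Э-functions `𝔣 = 𝔣_a`
(`IsStrictEFunction a`, `𝔣_a = ∑ n!aₙxⁿ`), summed "in the direction `θ` [`= arg ξ = 0`] if `θ` is
not anti-Stokes, and [by] `𝒜_{θ+ε}⁻¹` for any small `ε > 0` if `θ` is anti-Stokes (this is
independent from the choice of such an `ε`)", with `𝒜_θ⁻¹𝔣(1/x) = ∫₀^{e^{iθ}∞} g(z)e^{−xz}dz`.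
Literally: EITHER the Borel ray of direction `0` can be used at `z = 1` (the `G`-series continues
analytically along `[0, ∞)` with absolutely convergent Laplace integral — for an Э-function this is
"`0` is not anti-Stokes") and `w` is that sum, OR it cannot, and `w` is the common value of the
sums along the rays of direction `d` for all sufficiently small `d > 0`. [FischlerRivoal2024, §1]
("`θ = 0` if it is not an anti-Stokes direction, and `θ > 0` very small otherwise … The ring `𝐃`
is [the one of the 2018 paper]") names the same ring; the mirror lateral choice is `antiEValues'`.
Printed facts: `𝐃` is a countable subring of `ℂ` containing the algebraic numbers (cf.
`one_mem_antiEValues`), Gompertz's constant and `√π·Ai(z)`, `z ∈ ℚ̄`; Conjecture 1 of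
[FischlerRivoal2024] is `eValues ∩ antiEValues = ℚ̄`. [cite: FischlerRivoal2018, §4.3] -/
def antiEValues : Set ℂ :=
  {w | ∃ a : ℕ → ℂ, IsStrictEFunction a ∧
    (IsBorelLaplaceSum a 0 1 w ∨
      ((¬ ∃ w₀, IsBorelLaplaceSum a 0 1 w₀) ∧
        ∃ ε : ℝ, 0 < ε ∧ ∀ d : ℝ, 0 < d → d < ε → IsBorelLaplaceSum a d 1 w))}

/-- Unfolding `antiEValues`. [cite: FischlerRivoal2018, §4.3] -/
theorem mem_antiEValues_iff (w : ℂ) :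
    w ∈ antiEValues ↔ ∃ a : ℕ → ℂ, IsStrictEFunction a ∧
      (IsBorelLaplaceSum a 0 1 w ∨
        ((¬ ∃ w₀, IsBorelLaplaceSum a 0 1 w₀) ∧
          ∃ ε : ℝ, 0 < ε ∧ ∀ d : ℝ, 0 < d → d < ε → IsBorelLaplaceSum a d 1 w)) :=
  Iff.rfl

/-- The regular case of `𝐃`: if the Э-function `𝔣_a` can be `1`-summed along the positive real
axis at `z = 1` ("if `θ` [`= 0`] is not anti-Stokes"), its sum `𝔣₀(1)` is an Э-value.
[cite: FischlerRivoal2018, §4.3] -/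
theorem mem_antiEValues_of_isBorelLaplaceSum_zero {a : ℕ → ℂ} {w : ℂ} (ha : IsStrictEFunction a)
    (hw : IsBorelLaplaceSum a 0 1 w) : w ∈ antiEValues :=
  ⟨a, ha, Or.inl hw⟩

/-- **The mirror ring `𝐃′`** (Fischler–Rivoal 2018, Remark 7 at the end of §4.3): as
`antiEValues`, but summing an anti-Stokes direction `0` laterally from the other side,
`𝒜_{θ−ε}⁻¹` (rays of direction `d < 0`, `|d|` small) — "we could have considered `𝒜_{θ−ε}⁻¹𝔣`
instead of `𝒜_{θ+ε}⁻¹𝔣` if `θ` is anti-Stokes. This defines also a ring `𝐃′`, and all properties of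
`𝐃` stated in this paper hold also with `𝐃′`. However we have not been able to prove that
`𝐃′ = 𝐃`." (It is also what the phrase "`θ > 0` very small" of [FischlerRivoal2024, §1] denotes if
`θ` is read there, as elsewhere in that paper, as a direction of the large variable, cf.
`IsAntiESum`.) [cite: FischlerRivoal2018, §4.3 (Remark 7)] -/
def antiEValues' : Set ℂ :=
  {w | ∃ a : ℕ → ℂ, IsStrictEFunction a ∧
    (IsBorelLaplaceSum a 0 1 w ∨
      ((¬ ∃ w₀, IsBorelLaplaceSum a 0 1 w₀) ∧
        ∃ ε : ℝ, 0 < ε ∧ ∀ d : ℝ, -ε < d → d < 0 → IsBorelLaplaceSum a d 1 w))}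

/-- Unfolding `antiEValues'`. [cite: FischlerRivoal2018, §4.3 (Remark 7)] -/
theorem mem_antiEValues'_iff (w : ℂ) :
    w ∈ antiEValues' ↔ ∃ a : ℕ → ℂ, IsStrictEFunction a ∧
      (IsBorelLaplaceSum a 0 1 w ∨
        ((¬ ∃ w₀, IsBorelLaplaceSum a 0 1 w₀) ∧
          ∃ ε : ℝ, 0 < ε ∧ ∀ d : ℝ, -ε < d → d < 0 → IsBorelLaplaceSum a d 1 w)) :=
  Iff.rfl

/-- `𝐃` and `𝐃′` agree on their regular part: a sum along the positive real axis lies in both.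
[cite: FischlerRivoal2018, §4.3 (Remark 7)] -/
theorem mem_antiEValues'_of_isBorelLaplaceSum_zero {a : ℕ → ℂ} {w : ℂ} (ha : IsStrictEFunction a)
    (hw : IsBorelLaplaceSum a 0 1 w) : w ∈ antiEValues' :=
  ⟨a, ha, Or.inl hw⟩

/-! ### 4. Non-vacuity: the constant Э-function `1`; `1 ∈ 𝐃`, `1 ∈ 𝐃′` -/

/-- The coefficient sequence `(1, 0, 0, …)` of the constant `E`-function `1`. [folklore] -/
def deltaZero (n : ℕ) : ℂ :=
  if n = 0 then 1 else 0

/-- `deltaZero 0 = 1`. [folklore] -/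
@[simp] theorem deltaZero_zero : deltaZero 0 = 1 := rfl

/-- `deltaZero n = 0` for `n ≠ 0`. [folklore] -/
theorem deltaZero_of_ne_zero {n : ℕ} (hn : n ≠ 0) : deltaZero n = 0 := if_neg hn

/-- The `E`-series of `(1, 0, 0, …)` is the constant function `1`. [folklore] -/
theorem eSeries_deltaZero : eSeries deltaZero = fun _ => 1 := by
  funext z
  rw [eSeries, tsum_eq_single 0 fun n hn => by simp [deltaZero_of_ne_zero hn]]
  simp

/-- **The constant `1` is a (strict) `E`-function**: coefficients `(1, 0, 0, …)` (algebraic, with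
conjugates of absolute value `≤ 1`, denominators `1`) and the equation `F′ = 0`; the source's
"`𝐄` … contains `ℚ̄*` … because algebraic numbers … are `E`-functions". PROVED.
[cite: FischlerRivoal2016, Definition 1] -/
theorem isStrictEFunction_deltaZero : IsStrictEFunction deltaZero := by
  refine ⟨fun n => ?_, ?_, ?_, ?_⟩
  · by_cases hn : n = 0
    · subst hn; simpa using isAlgebraic_one
    · rw [deltaZero_of_ne_zero hn]; exact isAlgebraic_zero
  · -- the ODE `0·F + 1·F' = 0`
    refine ⟨1, ![0, 1], ?_, ?_, ?_⟩
    · intro h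
      have := congr_fun h 1
      simp at this
    · intro j k
      fin_cases j
      · simp only [Fin.zero_eta, Fin.isValue, Matrix.cons_val_zero, Polynomial.coeff_zero]
        exact isAlgebraic_zero
      · simp only [Fin.mk_one, Fin.isValue, Matrix.cons_val_one, Matrix.cons_val_fin_one,
          Polynomial.coeff_one]
        split_ifs
        · exact isAlgebraic_one
        · exact isAlgebraic_zero
    · intro z
      rw [eSeries_deltaZero]
      simp [Fin.sum_univ_two, iteratedDeriv_succ, iteratedDeriv_zero]
  · refine ⟨1, one_pos, fun n b hb => ?_⟩
    by_cases hn : n = 0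
    · subst hn
      rw [deltaZero_zero, minpoly.one ℚ ℂ, Polynomial.mem_rootSet] at hb
      have hb1 : b = 1 := by
        have := hb.2
        simp only [map_sub, Polynomial.aeval_X, Polynomial.aeval_one] at this
        exact sub_eq_zero.mp this
      simp [hb1]
    · rw [deltaZero_of_ne_zero hn, minpoly.zero ℚ ℂ, Polynomial.mem_rootSet] at hb
      have hb0 : b = 0 := by simpa using hb.2
      simp [hb0]
  · refine ⟨fun _ => 1, 1, one_pos, fun n => ⟨le_rfl, by simp, fun m _ => ?_⟩⟩
    by_cases hm : m = 0
    · subst hm; simpa using isIntegral_one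
    · rw [deltaZero_of_ne_zero hm]; simpa using isIntegral_zero

/-- **The constant formal series `1` is an Э-function** (`= 𝔣_a` for `a = (1, 0, 0, …)`); the
polynomial case in "Э-functions are divergent series, unless they are polynomials". PROVED.
[cite: FischlerRivoal2024, §1 (p. 3)] -/
theorem isAntiEFunction_one : IsAntiEFunction (1 : PowerSeries ℂ) := by
  have h1 : (1 : PowerSeries ℂ) = antiESeries deltaZero := by
    ext n
    rw [coeff_antiESeries, PowerSeries.coeff_one]
    by_cases hn : n = 0
    · subst hn; simp
    · simp [hn, deltaZero_of_ne_zero hn]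
  rw [h1, isAntiEFunction_antiESeries_iff]
  exact isStrictEFunction_deltaZero

/-- The constant `1` continues the `G`-series of `(1, 0, 0, …)` along every ray. [folklore] -/
theorem isBorelRayContinuation_deltaZero (d : ℝ) :
    IsBorelRayContinuation deltaZero d fun _ => 1 := by
  refine ⟨⟨univ, isOpen_univ, subset_univ _, differentiableOn_const 1⟩, ?_⟩
  refine Eventually.of_forall fun ξ => ?_
  have : (fun n => deltaZero n * ξ ^ n) = fun n => if n = 0 then 1 else 0 := by
    funext n
    by_cases hn : n = 0
    · subst hn; simp
    · simp [deltaZero_of_ne_zero hn, hn]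
  rw [this]
  simpa using hasSum_ite_eq 0 (1 : ℂ)

/-- For `|d| < π/2` the Borel–Laplace sum of the constant Э-function `1` along the ray of
direction `d` at `z = 1` is `∫₀^∞ e^{−re^{id}} e^{id} dr = 1`. PROVED. [folklore] -/
theorem isBorelLaplaceSum_deltaZero_one {d : ℝ} (hd : d ∈ Ioo (-(Real.pi / 2)) (Real.pi / 2)) :
    IsBorelLaplaceSum deltaZero d 1 1 := by
  -- the exponent `A = -e^{id}` has negative real part `-cos d`
  set e : ℂ := cexp ((d : ℂ) * I) with he
  set A : ℂ := -e with hA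
  have hcos : 0 < Real.cos d := Real.cos_pos_of_mem_Ioo hd
  have hAre : A.re < 0 := by
    have : e.re = Real.cos d := by
      rw [he, Complex.exp_ofReal_mul_I_re]
    rw [hA, Complex.neg_re, this]
    linarith
  have hint_eq : antiELaplaceIntegrand (fun _ => (1 : ℂ)) d 1 =
      fun r : ℝ => e * cexp (A * (r : ℂ)) := by
    funext r
    simp only [antiELaplaceIntegrand, mul_one, one_mul, hA, he]
    congr 1
    ring_nf
  refine ⟨fun _ => 1, isBorelRayContinuation_deltaZero _, ?_, ?_⟩
  · rw [hint_eq]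
    exact (integrableOn_exp_mul_complex_Ioi hAre 0).const_mul e
  · rw [antiELaplace, one_mul, hint_eq, integral_const_mul, integral_exp_mul_complex_Ioi hAre 0]
    simp only [Complex.ofReal_zero, mul_zero, Complex.exp_zero, hA]
    have he0 : e ≠ 0 := Complex.exp_ne_zero _
    field_simp

/-- In the [FischlerRivoal2024] labelling: `𝔣_θ(1) = 1` for the constant Э-function `1` and every
`|θ| < π/2`. PROVED. [folklore] -/
theorem isAntiESum_deltaZero_one {θ : ℝ} (hθ : θ ∈ Ioo (-(Real.pi / 2)) (Real.pi / 2)) :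
    IsAntiESum deltaZero θ 1 1 :=
  isBorelLaplaceSum_deltaZero_one ⟨by linarith [hθ.2], by linarith [hθ.1]⟩

/-- **`1 ∈ 𝐃`** (PROVED): the constant Э-function `1 = 𝔣_a`, `a = (1, 0, 0, …)`, has `G`-series `1`,
the direction `0` is regular, and `𝔣₀(1) = ∫₀^∞ e^{−t} dt = 1`; an instance of the printed "`𝐃` …
contains algebraic numbers", witnessing that `antiEValues` is inhabited.
[cite: FischlerRivoal2018, §4.3] -/
theorem one_mem_antiEValues : (1 : ℂ) ∈ antiEValues :=
  mem_antiEValues_of_isBorelLaplaceSum_zero isStrictEFunction_deltaZero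
    (isBorelLaplaceSum_deltaZero_one ⟨by linarith [Real.pi_pos], by linarith [Real.pi_pos]⟩)

/-- **`1 ∈ 𝐃′`** likewise (PROVED). [cite: FischlerRivoal2018, §4.3 (Remark 7)] -/
theorem one_mem_antiEValues' : (1 : ℂ) ∈ antiEValues' :=
  mem_antiEValues'_of_isBorelLaplaceSum_zero isStrictEFunction_deltaZero
    (isBorelLaplaceSum_deltaZero_one ⟨by linarith [Real.pi_pos], by linarith [Real.pi_pos]⟩)

/-! ### 5. Fischler–Rivoal's example: the binomial Э-function `∑ s(s−1)⋯(s−n+1) zⁿ`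

`𝔣(z) = ∑ₙ s(s−1)⋯(s−n+1) zⁿ = ∑ₙ n!·C(s,n)·zⁿ = 𝔣_a` with `aₙ = C(s,n) = Ring.choose s n`; its
`G`-series is the binomial series `∑ C(s,n)ξⁿ = (1+ξ)^s` and "this `1`-summation is
`∫₀^∞ (1+tz)^s e^{−t} dt`" [FischlerRivoal2024, §5.2]. We prove the analytic half. -/

/-- `1 + r e^{id}` lies in Mathlib's slit plane `ℂ ∖ (−∞, 0]` for `r ≥ 0` and `|d| < π`: the rays of
direction `|d| < π` avoid the cut `(−∞, −1]` of `(1+ξ)^s`. [folklore] -/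
theorem one_add_ofReal_mul_exp_mem_slitPlane {d r : ℝ} (hd : d ∈ Ioo (-Real.pi) Real.pi)
    (hr : 0 ≤ r) : 1 + (r : ℂ) * cexp (d * I) ∈ slitPlane := by
  rw [Complex.mem_slitPlane_iff]
  have hre : (1 + (r : ℂ) * cexp (d * I)).re = 1 + r * Real.cos d := by
    simp [Complex.exp_ofReal_mul_I_re, Complex.exp_ofReal_mul_I_im]
  have him : (1 + (r : ℂ) * cexp (d * I)).im = r * Real.sin d := by
    simp [Complex.exp_ofReal_mul_I_re, Complex.exp_ofReal_mul_I_im]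
  rw [hre, him]
  rcases eq_or_lt_of_le hr with rfl | hr'
  · left; simp
  · by_cases hsin : Real.sin d = 0
    · have hd0 : d = 0 := (Real.sin_eq_zero_iff_of_lt_of_lt hd.1 hd.2).1 hsin
      left
      rw [hd0, Real.cos_zero, mul_one]
      linarith
    · right
      exact mul_ne_zero hr'.ne' hsin

/-- **The Borel transform of the binomial Э-function is `(1+ξ)^s`, along every ray off the cut**
(PROVED): for every `s ∈ ℂ` and every direction `|d| < π`, `ξ ↦ (1+ξ)^s` (principal branch) is an
analytic continuation of the `G`-series `∑ C(s,n)ξⁿ` along `borelRay d` — holomorphic on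
`{ξ : 1 + ξ ∉ (−∞, 0]}` ⊇ ray, and equal to the binomial series on `|ξ| < 1`
(`Complex.one_add_cpow_hasFPowerSeriesOnBall_zero`). In particular the only possible anti-Stokes
direction of `𝔣 = ∑ s(s−1)⋯(s−n+1)zⁿ` is the one through `ξ = −1` ("`0` is not an anti-Stokes
direction of `𝔣(z)`"). [cite: FischlerRivoal2024, §5.2] -/
theorem isBorelRayContinuation_one_add_cpow (s : ℂ) {d : ℝ} (hd : d ∈ Ioo (-Real.pi) Real.pi) :
    IsBorelRayContinuation (fun n => Ring.choose s n) d fun ξ => (1 + ξ) ^ s := by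
  refine ⟨⟨{ξ : ℂ | 1 + ξ ∈ slitPlane}, ?_, ?_, ?_⟩, ?_⟩
  · exact Complex.isOpen_slitPlane.preimage (by fun_prop)
  · rintro _ ⟨r, hr, rfl⟩
    exact one_add_ofReal_mul_exp_mem_slitPlane hd hr
  · intro ξ hξ
    exact ((differentiableAt_id.const_add 1).cpow (differentiableAt_const s) hξ).differentiableWithinAt
  · have hball : Metric.eball (0 : ℂ) 1 ∈ 𝓝 (0 : ℂ) := Metric.eball_mem_nhds 0 one_pos
    filter_upwards [hball] with ξ hξ
    have h := (Complex.one_add_cpow_hasFPowerSeriesOnBall_zero (a := s)).hasSum hξ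
    have hcoeff : ∀ n, (binomialSeries ℂ s).coeff n = Ring.choose s n := fun n => by
      rw [binomialSeries, FormalMultilinearSeries.coeff_ofScalars]
    simp only [FormalMultilinearSeries.apply_eq_pow_smul_coeff, hcoeff, smul_eq_mul,
      zero_add] at h
    simpa [mul_comm] using h

/-- **"This `1`-summation is `∫₀^∞ (1 + t/x)^s e^{−t} dt`"** (PROVED, for `Re s ≤ 0`): for real
`x > 0` the Э-series `𝔣_a(1/x)`, `aₙ = C(s,n)`, is Borel–Laplace summable along the positive real
axis (direction `0`, both labellings) with sum `∫₀^∞ e^{−t}(1 + t/x)^s dt` — the Laplace integral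
`x∫₀^∞ e^{−xξ}(1+ξ)^s dξ` converges absolutely since `|(1+ξ)^s| = (1+ξ)^{Re s} ≤ 1`. (The source
states it for `s ∈ ℚ ∖ ℤ_{≥0}`; the case `Re s > 0`, which needs the Gamma integral for the
convergence, is not treated here.) [cite: FischlerRivoal2024, §5.2] -/
theorem isBorelLaplaceSum_binomial {s : ℂ} (hs : s.re ≤ 0) {x : ℝ} (hx : 0 < x) :
    IsBorelLaplaceSum (fun n => Ring.choose s n) 0 x
      (∫ t in Ioi (0 : ℝ), cexp (-(t : ℂ)) * (1 + (t : ℂ) / x) ^ s) := by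
  have hd : (0 : ℝ) ∈ Ioo (-Real.pi) Real.pi := ⟨by linarith [Real.pi_pos], Real.pi_pos⟩
  refine ⟨fun ξ => (1 + ξ) ^ s, isBorelRayContinuation_one_add_cpow s hd, ?_, ?_⟩
  · -- integrability: `‖e^{-x r}(1+r)^s‖ ≤ e^{-x r}`
    have hint_eq : antiELaplaceIntegrand (fun ξ => (1 + ξ) ^ s) 0 x =
        fun r : ℝ => cexp (-x * (r : ℂ)) * (1 + (r : ℂ)) ^ s := by
      funext r
      simp only [antiELaplaceIntegrand, Complex.ofReal_zero, zero_mul, Complex.exp_zero, one_mul,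
        mul_one]
      ring_nf
    rw [hint_eq]
    have hmeas : AEStronglyMeasurable (fun r : ℝ => cexp (-x * (r : ℂ)) * (1 + (r : ℂ)) ^ s)
        (volume.restrict (Ioi 0)) := by
      refine ContinuousOn.aestronglyMeasurable (fun r hr => ?_) measurableSet_Ioi
      refine ContinuousAt.continuousWithinAt ?_
      refine ContinuousAt.mul (by fun_prop) ?_
      refine ContinuousAt.cpow (by fun_prop) continuousAt_const ?_
      have : (1 + (r : ℂ)) = ((1 + r : ℝ) : ℂ) := by push_cast; ring
      rw [this, Complex.ofReal_mem_slitPlane]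
      linarith [mem_Ioi.1 hr]
    have hexp : IntegrableOn (fun r : ℝ => cexp (-x * (r : ℂ))) (Ioi 0) := by
      have := integrableOn_exp_mul_complex_Ioi (a := -x) (by simpa using hx) 0
      simpa using this
    refine Integrable.mono' hexp.norm hmeas ?_
    refine (ae_restrict_iff' measurableSet_Ioi).2 (Eventually.of_forall fun r hr => ?_)
    rw [norm_mul]
    have h1r : 0 < 1 + r := by linarith [mem_Ioi.1 hr]
    have hcpow : ‖(1 + (r : ℂ)) ^ s‖ ≤ 1 := by
      have : (1 + (r : ℂ)) = ((1 + r : ℝ) : ℂ) := by push_cast; ring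
      rw [this, Complex.norm_cpow_eq_rpow_re_of_pos h1r]
      exact Real.rpow_le_one_of_one_le_of_nonpos (by linarith [mem_Ioi.1 hr]) hs
    calc ‖cexp (-x * (r : ℂ))‖ * ‖(1 + (r : ℂ)) ^ s‖ ≤ ‖cexp (-x * (r : ℂ))‖ * 1 := by gcongr
      _ = ‖cexp (-x * (r : ℂ))‖ := mul_one _
  · rw [antiELaplace_zero_ofReal _ hx]

/-- The same at `x = 1`: `𝔣₀(1) = ∫₀^∞ e^{−t}(1+t)^s dt` for `aₙ = C(s,n)`, `Re s ≤ 0` (PROVED).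
[cite: FischlerRivoal2024, §5.2] -/
theorem isBorelLaplaceSum_binomial_one {s : ℂ} (hs : s.re ≤ 0) :
    IsBorelLaplaceSum (fun n => Ring.choose s n) 0 1
      (∫ t in Ioi (0 : ℝ), cexp (-(t : ℂ)) * (1 + (t : ℂ)) ^ s) := by
  simpa only [Complex.ofReal_one, div_one] using isBorelLaplaceSum_binomial hs one_pos

/-- In the [FischlerRivoal2024] labelling: `𝔣₀(1/x) = ∫₀^∞ e^{−t}(1 + t/x)^s dt` (`Re s ≤ 0`,
`x > 0`). PROVED. [cite: FischlerRivoal2024, §5.2] -/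
theorem isAntiESum_binomial {s : ℂ} (hs : s.re ≤ 0) {x : ℝ} (hx : 0 < x) :
    IsAntiESum (fun n => Ring.choose s n) 0 x
      (∫ t in Ioi (0 : ℝ), cexp (-(t : ℂ)) * (1 + (t : ℂ) / x) ^ s) :=
  (isAntiESum_zero_iff _ _ _).2 (isBorelLaplaceSum_binomial hs hx)

/-- **`∫₀^∞ e^{−t}(1+t)^s dt ∈ 𝐃`, conditionally on the arithmetic half.** The source's Э-value
`∫₀^∞ (t+α)^s e^{−t} dt` at `α = 1` ("𝔣₀(1/α) [∈ 𝐃] … this `1`-summation is `∫₀^∞(1+tz)^s e^{−t}dt`";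
Corollary 1: transcendental under Conjecture 2, for `s ∈ ℚ ∖ ℤ_{≥0}`; `s = −1` is Gompertz's
constant, `s = −1/2` the value `∫₀^∞ e^{−t}/√(1+t) dt` of route StokesConstantPi): by the PROVED
analytic half (`isBorelLaplaceSum_binomial_one`, direction `0` regular) it lies in `antiEValues` as
soon as `aₙ = C(s,n)` is an `E`-coefficient sequence (`IsStrictEFunction`; printed for `s ∈ ℚ`:
"the Э-function `𝔣(z) := ∑ s(s−1)⋯(s−n+1)zⁿ`", not proved in this file — hence the explicit
hypothesis). [cite: FischlerRivoal2024, §5.2] -/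
theorem integral_mem_antiEValues_of_isStrictEFunction {s : ℂ} (hs : s.re ≤ 0)
    (ha : IsStrictEFunction fun n => Ring.choose s n) :
    (∫ t in Ioi (0 : ℝ), cexp (-(t : ℂ)) * (1 + (t : ℂ)) ^ s) ∈ antiEValues :=
  mem_antiEValues_of_isBorelLaplaceSum_zero ha (isBorelLaplaceSum_binomial_one hs)

end Literature.NumberTheory.Transcendental
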